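import Summits.ABC.IUTFork.Cor312PinnedThetaRealSharpNegativeCriterion
import Summits.ABC.IUTFork.Cor312PinnedThetaRealSharpNegativePr
import HarnessLib

/-!
# [IUTchIII] Cor. 3.12 — PR-1's Θ-PIN at the PRINT-NORMALISED sharp real setting `Real.settingPrVolSharp`: the
# NEGATIVE from ANY (Ind2) mover of the unit ball (tame `2 ≤ e ≤ p₀ − 2`, any `f`; wild-inclusive form)

PROOF-ONLY sequel (0 definitions, 0 named facts; abc-iut cell, WAVE-5 prover seat abc-iut-w5-d044, gen 5) to
`Cor312PinnedThetaRealSharpNegativeCriterion` (this seat: w4-d087's Θ-pin negative with the Dupuy–Hilado (Ind2) mover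
ABSTRACTED, instances from abc-iut-w5-d180's ball-mover criterion p432150) and abc-iut-w4-d087's
`Cor312PinnedThetaRealSharpNegativePr` (p431122: the Θ-regions of `Real.settingPrVolSharp` ARE those of
`Real.settingDHVolSharp`, `thetaRegion_settingPrVolSharp_eq_settingDHVolSharp`, `rfl`). TAKES NO SIDE on [IUTchIII] Cor. 3.12.

`Real.settingPrVolSharp` (abc-iut-c312-1/c312-7) is the setting branch C's certificates pin their data to
(`Conditional/AbcOfSShrink2.lean` binds `hPin : Cor312Vol.PinnedRegions …` AT `settingPrVolSharp (X P l T) …`). Transported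
here: the one-place (Ind2) generator built from ANY `ψ ∈ Real.ismDH (analyticLogv F) (inr v₀)` moving the unit ball
`𝒪_{v₀}` moves the label-`0` Θ-region of `settingPrVolSharp` at `(0, p₀)`; hence PR-1's Θ-pin, `PinnedRegions` (v2 /
Shrink2 shape) and `PinnedRegions3` (v1 shape) are UNSATISFIABLE there — for every region-forming operator `ρ`, every `qK`,
ideles, context binders, columns — as soon as `F` has ONE finite place `v₀` with no place of `S` over its prime `p₀` and
EITHER `p₀` odd with `2 ≤ e(v₀|p₀) ≤ p₀ − 2` (ANY residue degree; `…_of_tame`) OR, wild ramification included, the unit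
ball of `K_{v₀}` is no `p₀^k·log_{p₀}(𝒪_{v₀}^×)` (`…_of_forall_ne`). w4-d087's p431122 was the case `e = 2`, `f = 1`, `p₀ ≥ 5`.

READING (neutral): under DH's (Ind2) reading (`Aut_{ℚ_p}(K_v : I_v)`) the idele-box Θ-regions cannot instantiate print's
Θ-pin at such `F`; the (Ind2)-stable lattice boxes / the isometry reading are the pin-compatible readings. For branch C
this widens the VACUITY GUARD: binding `hPin` AT `settingPrVolSharp` gives a jointly unsatisfiable hypothesis group at every
such `F`. HONEST SCOPE: OUR interface + OUR sharp real container under ONE reading of (Ind2); nothing bears on print's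
(xi-e)/(xi-f). [claim: Mochizuki2012, status: disputed]; [cite: DupuyHilado2025, §3.9, §4.9]; [cite: ScholzeStix2018, §2.2 pp. 9–10].
Consumed BY NAME, nothing restated. typed ≠ proved; instantiated ≠ endorsed.
-/

noncomputable section

open Metric Set
open scoped Pointwise

namespace Summit.ABC.IUTFork.Thm311.Real

open Cor312 Cor312Vol Literature.IUT.LogThetaLattice Literature.IUT.LogVolume Literature.NumberTheory.NumberFields
  NumberField IsDedekindDomain

variable {F : Type} [Field F] [NumberField F] (X : PilotData F)
  (M : Type) [Field M] [NumberField M]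
  (archPk : ∀ (j : (thetaIndex X).Label) (vQ : (thetaIndex X).VQ),
    Set ((logShellsDH X (analyticLogv F)).Packet j vQ))
  (archSub : ∀ (j : (thetaIndex X).Label) (v : (thetaIndex X).V),
    Set ((logShellsDH X (analyticLogv F)).Packet j ((thetaIndex X).over v)))
  (Ψ : ℤ → ∀ v : (thetaIndex X).V, v ∈ (thetaIndex X).Vbad → Set ((logShellsDH X (analyticLogv F)).StarPacket v))
  (act : ℤ → ∀ v : (thetaIndex X).V, v ∈ (thetaIndex X).Vbad →
    (logShellsDH X (analyticLogv F)).StarPacket v →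
      Module.End ℚ ((logShellsDH X (analyticLogv F)).StarPacket v))
  (Mmod : ℤ → ∀ j : (thetaIndex X).LabelStar, Set ((logShellsDH X (analyticLogv F)).GlobalPacket j.1))
  (region : ℤ → ∀ j : (thetaIndex X).LabelStar, FinDivisor M → ∀ vQ : (thetaIndex X).VQ,
    Set ((logShellsDH X (analyticLogv F)).Packet j.1 vQ))
  (n : ℤ) {HT : Type} {LogLink : HT → HT → Type} {IsFull : ∀ {s t : HT}, LogLink s t → Prop}
  (lat : LGPGaussianLogThetaLattice LogLink IsFull)
  {Frd : Type} {IsoF : Frd → Frd → Type} {Ob : Frd → Type} {realify : Frd → Frd} {Strip : Type}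
  {IsoS : Strip → Strip → Type} {Mv : ∀ v : (thetaIndex X).V, v ∈ (thetaIndex X).Vbad → Type}
  [∀ v h, Monoid (Mv v h)]
  (sig : GlobalLGPFrobenioidSignature (thetaIndex X).lstar (thetaIndex X).V (· ∈ (thetaIndex X).Vbad)
    Frd IsoF Ob realify Strip IsoS Mv)
  (split : SplittingMonoids Mv) {ObΔ : Type} {N : ∀ v : (thetaIndex X).V, v ∈ (thetaIndex X).Vbad → Type}
  [∀ v h, Monoid (N v h)] (qData : QPilotData ObΔ N)
  (tq : ∀ (pp : Nat.Primes) (x : (thetaIndex X).Fibre (.inr pp)),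
    haveI : Fact (pp : ℕ).Prime := ⟨pp.2⟩; kOf X pp.1 x)
  (t : ∀ (pp : Nat.Primes) (_ : Fin X.lstar) (x : (thetaIndex X).Fibre (.inr pp)),
    haveI : Fact (pp : ℕ).Prime := ⟨pp.2⟩; kOf X pp.1 x)
  (htq0 : ∀ pp x, tq pp x ≠ 0)
  (htq1 : ∀ (pp : Nat.Primes) (x : (thetaIndex X).Fibre (.inr pp)),
    haveI : Fact (pp : ℕ).Prime := ⟨pp.2⟩; placeOf X pp.1 x ∉ X.S → ‖tq pp x‖ = 1)
  (col : ℤ → Column (logShellsDH X (analyticLogv F)))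
  (ρ : (∀ v : (thetaIndex X).V, v ∈ (thetaIndex X).Vbad → Set ((logShellsDH X (analyticLogv F)).StarPacket v)) →
    ∀ (j : (thetaIndex X).Label) (vQ : (thetaIndex X).VQ), Set ((logShellsDH X (analyticLogv F)).Packet j vQ))
  (qK : ∀ v : (thetaIndex X).V, v ∈ (thetaIndex X).Vbad → Set ((logShellsDH X (analyticLogv F)).StarPacket v))

/-- The one-place (Ind2) generator built from ANY mover of the unit ball at `v₀` MOVES the label-`0` Θ-region of
`Real.settingPrVolSharp` at `(0, p₀)` (every `m`) and is the identity on every star packet over a rational place `≠ p₀`.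
[cite: DupuyHilado2025, §3.9, §4.9] [claim: Mochizuki2012, status: disputed] -/
theorem exists_ind2_starTrivial_moves_thetaRegion_zero_settingPrVolSharp_of_exists_mover
    (pp : Nat.Primes) (v₀ : HeightOneSpectrum (𝓞 F)) (hv₀ : (thetaIndex X).over (.inr v₀) = .inr pp)
    (hmov : ∃ ψ ∈ ismDH (analyticLogv F) (.inr v₀ : Place F),
      ⇑ψ '' (integers v₀ : Set (Carrier (.inr v₀ : Place F))) ≠ integers v₀) :
    ∃ Φ₀ ∈ (logShellsDH X (analyticLogv F)).Ind2Family,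
      (∀ v : (thetaIndex X).V, (thetaIndex X).over v ≠ .inr pp →
        (logShellsDH X (analyticLogv F)).starAut Φ₀ v = LinearEquiv.refl ℚ _) ∧
      ∀ m : ℤ, ⇑(Φ₀ 0 (.inr pp)) ''
          (settingPrVolSharp X (logvAnalytic_analyticLogv (F := F)) M archPk archSub Ψ act Mmod region n lat sig
            split qData tq t htq0 htq1).thetaRegion m 0 (.inr pp) ≠
        (settingPrVolSharp X (logvAnalytic_analyticLogv (F := F)) M archPk archSub Ψ act Mmod region n lat sig
            split qData tq t htq0 htq1).thetaRegion m 0 (.inr pp) := by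
  obtain ⟨Φ₀, hΦ₀, hstar, hmv⟩ :=
    exists_ind2_starTrivial_moves_thetaRegion_zero_settingDHVolSharp_of_exists_mover X M archPk archSub Ψ act Mmod
      region n lat sig split qData tq t htq0 htq1 pp v₀ hv₀ hmov
  refine ⟨Φ₀, hΦ₀, hstar, fun m => ?_⟩
  rw [thetaRegion_settingPrVolSharp_eq_settingDHVolSharp]
  exact hmv m

/-- **PR-1's Θ-PIN FAILS, for EVERY `ρ`, at `Real.settingPrVolSharp`** as soon as some `ψ ∈ Real.ismDH (analyticLogv F) (inr v₀)`
moves the unit ball at ONE finite place `v₀` whose prime `p₀` carries no place of `S`.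
[cite: DupuyHilado2025, §4.9] [claim: Mochizuki2012, status: disputed] -/
theorem not_thetaPinned_settingPrVolSharp_of_exists_mover
    (pp : Nat.Primes) (v₀ : HeightOneSpectrum (𝓞 F)) (hv₀ : (thetaIndex X).over (.inr v₀) = .inr pp)
    (hmov : ∃ ψ ∈ ismDH (analyticLogv F) (.inr v₀ : Place F),
      ⇑ψ '' (integers v₀ : Set (Carrier (.inr v₀ : Place F))) ≠ integers v₀)
    (hS : ∀ v ∈ (thetaIndex X).Vbad, (thetaIndex X).over v ≠ .inr pp) :
    ¬ ThetaPinned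
        ({ toSituation := situationPrVol X (logvAnalytic_analyticLogv (F := F)) M archPk archSub Ψ act Mmod region,
           col := col } : LatticeSituation (thetaIndex X))
        (settingPrVolSharp X (logvAnalytic_analyticLogv (F := F)) M archPk archSub Ψ act Mmod region n lat sig
          split qData tq t htq0 htq1) ρ := by
  intro hpin
  obtain ⟨Φ₀, hΦ₀, hstar, hmv⟩ :=
    exists_ind2_starTrivial_moves_thetaRegion_zero_settingPrVolSharp_of_exists_mover X M archPk archSub Ψ act Mmod
      region n lat sig split qData tq t htq0 htq1 pp v₀ hv₀ hmov
  refine hmv 0 (Cor312Vol.image_thetaRegion_eq_of_thetaPinned hpin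
    (Subgroup.subset_closure (Set.mem_union_right _ hΦ₀)) ?_ 0 0 (.inr pp))
  intro v hv A
  have h := hstar v (hS v hv)
  change ⇑((logShellsDH X (analyticLogv F)).starAut Φ₀ v) '' A = A
  rw [h]
  exact Set.image_id' A

/-- … hence PR-1's two pins `PinnedRegions` — the `hPin` shape of branch C's v2 / Shrink2 certificates — fail at
`Real.settingPrVolSharp` for every `ρ`, `qK`. [claim: Mochizuki2012, status: disputed] -/
theorem not_pinnedRegions_settingPrVolSharp_of_exists_mover
    (pp : Nat.Primes) (v₀ : HeightOneSpectrum (𝓞 F)) (hv₀ : (thetaIndex X).over (.inr v₀) = .inr pp)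
    (hmov : ∃ ψ ∈ ismDH (analyticLogv F) (.inr v₀ : Place F),
      ⇑ψ '' (integers v₀ : Set (Carrier (.inr v₀ : Place F))) ≠ integers v₀)
    (hS : ∀ v ∈ (thetaIndex X).Vbad, (thetaIndex X).over v ≠ .inr pp) :
    ¬ PinnedRegions
        ({ toSituation := situationPrVol X (logvAnalytic_analyticLogv (F := F)) M archPk archSub Ψ act Mmod region,
           col := col } : LatticeSituation (thetaIndex X))
        (settingPrVolSharp X (logvAnalytic_analyticLogv (F := F)) M archPk archSub Ψ act Mmod region n lat sig
          split qData tq t htq0 htq1) ρ qK := fun h =>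
  not_thetaPinned_settingPrVolSharp_of_exists_mover X M archPk archSub Ψ act Mmod region n lat sig split qData tq t
    htq0 htq1 col ρ pp v₀ hv₀ hmov hS h.1

/-- … and `PinnedRegions3` (two pins ∧ link pin) at `Real.settingPrVolSharp`. [claim: Mochizuki2012, status: disputed] -/
theorem not_pinnedRegions3_settingPrVolSharp_of_exists_mover
    (pp : Nat.Primes) (v₀ : HeightOneSpectrum (𝓞 F)) (hv₀ : (thetaIndex X).over (.inr v₀) = .inr pp)
    (hmov : ∃ ψ ∈ ismDH (analyticLogv F) (.inr v₀ : Place F),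
      ⇑ψ '' (integers v₀ : Set (Carrier (.inr v₀ : Place F))) ≠ integers v₀)
    (hS : ∀ v ∈ (thetaIndex X).Vbad, (thetaIndex X).over v ≠ .inr pp) :
    ¬ PinnedRegions3
        ({ toSituation := situationPrVol X (logvAnalytic_analyticLogv (F := F)) M archPk archSub Ψ act Mmod region,
           col := col } : LatticeSituation (thetaIndex X))
        (settingPrVolSharp X (logvAnalytic_analyticLogv (F := F)) M archPk archSub Ψ act Mmod region n lat sig
          split qData tq t htq0 htq1) ρ qK := fun h =>
  not_pinnedRegions_settingPrVolSharp_of_exists_mover X M archPk archSub Ψ act Mmod region n lat sig split qData tq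
    t htq0 htq1 col ρ qK pp v₀ hv₀ hmov hS h.1

/-- **TAME PLACES, ANY RESIDUE DEGREE: `PinnedRegions` FAILS at `Real.settingPrVolSharp`** as soon as `F` has ONE place
`v₀` over an odd prime `p₀` with `2 ≤ e(v₀|p₀) ≤ p₀ − 2` and no place of `S` over `p₀`.
[cite: DupuyHilado2025, §4.9] [claim: Mochizuki2012, status: disputed] -/
theorem not_pinnedRegions_settingPrVolSharp_of_tame
    (pp : Nat.Primes) (hp2 : 2 < (pp : ℕ)) (v₀ : HeightOneSpectrum (𝓞 F))
    (hv₀ : (thetaIndex X).over (.inr v₀) = .inr pp)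
    (he2 : 2 ≤ v₀.asIdeal.ramificationIdx ℤ) (hep : v₀.asIdeal.ramificationIdx ℤ ≤ (pp : ℕ) - 2)
    (hS : ∀ v ∈ (thetaIndex X).Vbad, (thetaIndex X).over v ≠ .inr pp) :
    ¬ PinnedRegions
        ({ toSituation := situationPrVol X (logvAnalytic_analyticLogv (F := F)) M archPk archSub Ψ act Mmod region,
           col := col } : LatticeSituation (thetaIndex X))
        (settingPrVolSharp X (logvAnalytic_analyticLogv (F := F)) M archPk archSub Ψ act Mmod region n lat sig
          split qData tq t htq0 htq1) ρ qK :=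
  haveI : Fact (pp : ℕ).Prime := ⟨pp.2⟩
  not_pinnedRegions_settingPrVolSharp_of_exists_mover X M archPk archSub Ψ act Mmod region n lat sig split qData tq t
    htq0 htq1 col ρ qK pp v₀ hv₀
    (exists_ismDH_image_integers_ne_of_tame pp hp2 v₀ (natCast_mem_placeOf X pp ⟨.inr v₀, hv₀⟩) he2 hep) hS

/-- The same for `PinnedRegions3`. [claim: Mochizuki2012, status: disputed] -/
theorem not_pinnedRegions3_settingPrVolSharp_of_tame
    (pp : Nat.Primes) (hp2 : 2 < (pp : ℕ)) (v₀ : HeightOneSpectrum (𝓞 F))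
    (hv₀ : (thetaIndex X).over (.inr v₀) = .inr pp)
    (he2 : 2 ≤ v₀.asIdeal.ramificationIdx ℤ) (hep : v₀.asIdeal.ramificationIdx ℤ ≤ (pp : ℕ) - 2)
    (hS : ∀ v ∈ (thetaIndex X).Vbad, (thetaIndex X).over v ≠ .inr pp) :
    ¬ PinnedRegions3
        ({ toSituation := situationPrVol X (logvAnalytic_analyticLogv (F := F)) M archPk archSub Ψ act Mmod region,
           col := col } : LatticeSituation (thetaIndex X))
        (settingPrVolSharp X (logvAnalytic_analyticLogv (F := F)) M archPk archSub Ψ act Mmod region n lat sig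
          split qData tq t htq0 htq1) ρ qK := fun h =>
  not_pinnedRegions_settingPrVolSharp_of_tame X M archPk archSub Ψ act Mmod region n lat sig split qData tq t htq0 htq1
    col ρ qK pp hp2 v₀ hv₀ he2 hep hS h.1

/-- The tame negative with the hypothesis on `S` in the concrete form `∀ v ∈ S, residueChar F v ≠ p₀`.
[claim: Mochizuki2012, status: disputed] -/
theorem not_pinnedRegions_settingPrVolSharp_of_tame_of_residueChar_ne
    (pp : Nat.Primes) (hp2 : 2 < (pp : ℕ)) (v₀ : HeightOneSpectrum (𝓞 F))
    (hv₀ : (thetaIndex X).over (.inr v₀) = .inr pp)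
    (he2 : 2 ≤ v₀.asIdeal.ramificationIdx ℤ) (hep : v₀.asIdeal.ramificationIdx ℤ ≤ (pp : ℕ) - 2)
    (hS : ∀ v ∈ X.S, residueChar F v ≠ (pp : ℕ)) :
    ¬ PinnedRegions
        ({ toSituation := situationPrVol X (logvAnalytic_analyticLogv (F := F)) M archPk archSub Ψ act Mmod region,
           col := col } : LatticeSituation (thetaIndex X))
        (settingPrVolSharp X (logvAnalytic_analyticLogv (F := F)) M archPk archSub Ψ act Mmod region n lat sig
          split qData tq t htq0 htq1) ρ qK :=
  not_pinnedRegions_settingPrVolSharp_of_tame X M archPk archSub Ψ act Mmod region n lat sig split qData tq t htq0 htq1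
    col ρ qK pp hp2 v₀ hv₀ he2 hep (over_ne_of_residueChar_ne X pp hS)

/-- **WILD RAMIFICATION INCLUDED: `PinnedRegions` FAILS at `Real.settingPrVolSharp`** as soon as `F` has ONE finite place
`v₀`, with no place of `S` over its prime `p₀`, whose unit ball is no `p₀^k·log_{p₀}(𝒪_{v₀}^×)` (`k ∈ ℤ`).
[cite: DupuyHilado2025, §4.9] [claim: Mochizuki2012, status: disputed] -/
theorem not_pinnedRegions_settingPrVolSharp_of_forall_ne
    (pp : Nat.Primes) (v₀ : HeightOneSpectrum (𝓞 F)) (hv₀ : (thetaIndex X).over (.inr v₀) = .inr pp)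
    (hv : ((pp : ℕ) : 𝓞 F) ∈ v₀.asIdeal)
    (hne : haveI : Fact (pp : ℕ).Prime := ⟨pp.2⟩
      ∀ k : ℤ, closedBall (0 : RescaledCompletion F pp v₀ hv) 1 ≠
        (((pp : ℕ) : ℚ_[pp]) ^ k) •
          (Literature.IUT.LogVolume.logUnits (RescaledCompletion F pp v₀ hv) : Set (RescaledCompletion F pp v₀ hv)))
    (hS : ∀ v ∈ (thetaIndex X).Vbad, (thetaIndex X).over v ≠ .inr pp) :
    ¬ PinnedRegions
        ({ toSituation := situationPrVol X (logvAnalytic_analyticLogv (F := F)) M archPk archSub Ψ act Mmod region,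
           col := col } : LatticeSituation (thetaIndex X))
        (settingPrVolSharp X (logvAnalytic_analyticLogv (F := F)) M archPk archSub Ψ act Mmod region n lat sig
          split qData tq t htq0 htq1) ρ qK :=
  not_pinnedRegions_settingPrVolSharp_of_exists_mover X M archPk archSub Ψ act Mmod region n lat sig split qData tq t
    htq0 htq1 col ρ qK pp v₀ hv₀ (exists_ismDH_image_integers_ne_of_forall_ne pp v₀ hv hne) hS

end Summit.ABC.IUTFork.Thm311.Real

end
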